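import Summits.ValiantsHypothesis.ValiantsHypothesis.Theorems.SymPencilPerFourTwoRowCorankTwo

/-!
# Route `SymPencil` — leaf R1C of the `(11, 5, 4)` cascade, point lemma (H): the Hessian reading at a
# `3 × 3` block — (cofactor entry) × (2 × 2 minor of the permanental cofactor matrix) vanishes
# (`--supports` stmt-ValiantsHypothesis-5674 `SdcSuperquadratic`; Theorems-side port / second proof of
# `stub_blockPoint33` of `Cruxes/SdcSuperquadratic/Lines/sing_five_classification.lean`, memo
# `SING-FIVE-CLASSIFICATION.md` §6.1; rung currency only)

A matrix `y` with zero row `3` and zero column `3` is a `3 × 3` block `Y`; write `C_{ρκ}` for the permanent of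
`Y` with row `ρ` and column `κ` deleted (permanental cofactors).  For every base point `u` the `s²`-coefficient of
`per₄ (u + s y)` is `u₃₃ · Σ C_{ρκ} u_{ρκ} + Σ C_{ρκ} u_{3κ} u_{ρ3}` and the `s³`-coefficient is `u₃₃ · per Y`.

* `permanent_test` — the explicit `s`-expansion on the six-cell test space
  `u = a E₃₃ + b E₀₀ + c₁ E₃₀ + c₂ E₃₁ + d₁ E₀₃ + d₂ E₁₃`: `s · b c₂ d₂ y₂₂ + s² · Q + s³ · a · per Y` with
  `Q = C₀₀ (ab + c₁d₁) + C₁₀ c₁d₂ + C₀₁ c₂d₁ + C₁₁ c₂d₂`;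
* `cofactor_master` — if all `3 × 3` subpermanents of `y` vanish (so `per Y = 0`) and `y` carries a per-direction
  family of four squares `Σ_{k<4} c_k Λ_k(u)²`, then `C₀₀ · (C₀₀ C₁₁ − C₀₁ C₁₀) = 0`: otherwise `Q` is non-degenerate on
  `K⁶` while the four `Λ_k` have a common zero there, which would lie in the radical (pattern of
  `SymPencilPerFourTwoRowCorankTwo.minors_of_sum_sq_swap_rows01`);
* `cofactor_product_eq_zero` — the same for EVERY ordering `(ρ₀,ρ₁,ρ₂)`, `(κ₀,κ₁,κ₂)` of the block rows and columns,
  i.e. for every `2 × 2` minor of `(C_{ρκ})` and each of its four cells (transport by `prodCongr σ τ`, ✓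
  `eval_perPoly_comp_prodCongr`, ✓ `sum_sq_swap_map`; `exists_perm_fix3` by `decide`).

Consumer: `SymPencilPerFourBlockPointCofactor` (the six transversal products vanish by explicit Nullstellensatz
certificates over these 36 products, then Frobenius–König).  Honest framing: [folklore]; a second proof, on the
Theorems side, of a leaf already proved inside the workfile (val-idea-18 g5 rev 7–8); leaf R1N and the cell file remain
OPEN; `27 ≤ sdc(per₄) ≤ 29` unchanged; the crux `SdcSuperquadratic` and `VP ≠ VNP` untouched; no summit statement is
proved here.  No definitions, no named facts.
-/

noncomputable section

set_option linter.dupNamespace false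

namespace Summit.ValiantsHypothesis.ValiantsHypothesis.Theorems.SymPencilPerFourBlockPointHessian

open Matrix Module MvPolynomial
open Literature.Computability.AlgebraicComplexity
open Summit.ValiantsHypothesis.ValiantsHypothesis.Theorems.SymPencilPerFourBlocks
open Summit.ValiantsHypothesis.ValiantsHypothesis.Theorems.SymPencilPerFourTwoRowCorankTwo

variable {K : Type*} [Field K]

/-! ## 1. The six-cell test space and the `s`-expansion of `per₄` on it -/

/-- The permanent of the test matrix: block `s · Y` with an extra `b` at `(0,0)`, border cells
`u₃₃ = a`, `u₃₀ = c₁`, `u₃₁ = c₂`, `u₀₃ = d₁`, `u₁₃ = d₂`. [folklore] -/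
theorem permanent_test (y : Fin 4 × Fin 4 → K) (a b c₁ c₂ d₁ d₂ s : K) :
    (Matrix.of ![![b + s * y (0, 0), s * y (0, 1), s * y (0, 2), d₁],
                 ![s * y (1, 0), s * y (1, 1), s * y (1, 2), d₂],
                 ![s * y (2, 0), s * y (2, 1), s * y (2, 2), 0],
                 ![c₁, c₂, 0, a]] : Matrix (Fin 4) (Fin 4) K).permanent =
      s * (b * c₂ * d₂ * y (2, 2)) +
      s ^ 2 * ((y (1, 1) * y (2, 2) + y (1, 2) * y (2, 1)) * (a * b + c₁ * d₁) +
        (y (0, 1) * y (2, 2) + y (0, 2) * y (2, 1)) * (c₁ * d₂) +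
        (y (1, 0) * y (2, 2) + y (1, 2) * y (2, 0)) * (c₂ * d₁) +
        (y (0, 0) * y (2, 2) + y (0, 2) * y (2, 0)) * (c₂ * d₂)) +
      s ^ 3 * (a * (y (0, 0) * (y (1, 1) * y (2, 2) + y (1, 2) * y (2, 1)) +
        y (0, 1) * (y (1, 0) * y (2, 2) + y (1, 2) * y (2, 0)) +
        y (0, 2) * (y (1, 0) * y (2, 1) + y (1, 1) * y (2, 0)))) := by
  rw [Matrix.permanent_fin_four_row]
  simp only [Matrix.of_apply, Matrix.cons_val', Matrix.cons_val_zero, Matrix.cons_val_one,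
    Matrix.cons_val, Matrix.empty_val', Matrix.cons_val_fin_one]
  ring

/-! ## 2. The master product `C₀₀ · (C₀₀ C₁₁ − C₀₁ C₁₀) = 0` -/

/-- **Hessian reading at a `3 × 3` block, master position.**  Let `y` have zero row `3` and zero
column `3`, all `3 × 3` subpermanents of `y` vanishing (so `per` of the block is `0`), and a
per-direction family of four squares at `y`.  With the permanental cofactors of the block
`C₀₀ = y₁₁y₂₂ + y₁₂y₂₁`, `C₁₁ = y₀₀y₂₂ + y₀₂y₂₀`, `C₀₁ = y₁₀y₂₂ + y₁₂y₂₀`, `C₁₀ = y₀₁y₂₂ + y₀₂y₂₁`: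
`C₀₀ · (C₀₀ C₁₁ − C₀₁ C₁₀) = 0`.  Proof: on the six cells `(3,3), (0,0), (3,0), (3,1), (0,3), (1,3)`
the `s²`-coefficient is `C₀₀ (ab + c₁d₁) + C₁₀ c₁d₂ + C₀₁ c₂d₁ + C₁₁ c₂d₂`, non-degenerate when
`C₀₀ ≠ 0` and the minor is `≠ 0`; four linear forms have a common zero on `K⁶`, which would be in
the radical. [folklore] -/
theorem cofactor_master [CharZero K] (y : Fin 4 × Fin 4 → K) (hr : ∀ m, y (3, m) = 0)
    (hc : ∀ m, y (m, 3) = 0)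
    (hS : ∀ (r c : Fin 3 → Fin 4), Function.Injective r → Function.Injective c →
      ((Matrix.of fun a b => y (a, b)).submatrix r c).permanent = 0)
    (hF : ∃ (c : Fin 4 → K) (Λ : Fin 4 → ((Fin 4 × Fin 4 → K) →ₗ[K] K)),
      ∀ u : Fin 4 × Fin 4 → K, ∃ e₀ e₁ : K, ∀ s : K,
        eval (u + s • y) (perPoly (Fin 4) K) = e₀ + s * e₁ + s ^ 2 * ∑ k, c k * (Λ k u) ^ 2) :
    (y (1, 1) * y (2, 2) + y (1, 2) * y (2, 1)) *
      ((y (1, 1) * y (2, 2) + y (1, 2) * y (2, 1)) * (y (0, 0) * y (2, 2) + y (0, 2) * y (2, 0)) -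
        (y (1, 0) * y (2, 2) + y (1, 2) * y (2, 0)) * (y (0, 1) * y (2, 2) + y (0, 2) * y (2, 1))) = 0 := by
  classical
  by_contra hne
  obtain ⟨hC, hM⟩ := mul_ne_zero_iff.1 hne
  obtain ⟨c, Λ, hfam⟩ := hF
  -- the test embedding `x ↦ x₀ E₃₃ + x₁ E₀₀ + x₂ E₃₀ + x₃ E₃₁ + x₄ E₀₃ + x₅ E₁₃`
  let emb : (Fin 6 → K) →ₗ[K] (Fin 4 × Fin 4 → K) :=
    (LinearMap.proj 0).smulRight (Pi.single (3, 3) 1 : Fin 4 × Fin 4 → K) +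
    (LinearMap.proj 1).smulRight (Pi.single (0, 0) 1 : Fin 4 × Fin 4 → K) +
    (LinearMap.proj 2).smulRight (Pi.single (3, 0) 1 : Fin 4 × Fin 4 → K) +
    (LinearMap.proj 3).smulRight (Pi.single (3, 1) 1 : Fin 4 × Fin 4 → K) +
    (LinearMap.proj 4).smulRight (Pi.single (0, 3) 1 : Fin 4 × Fin 4 → K) +
    (LinearMap.proj 5).smulRight (Pi.single (1, 3) 1 : Fin 4 × Fin 4 → K)
  have hemb : ∀ (x : Fin 6 → K) (p : Fin 4 × Fin 4), emb x p =
      x 0 * (Pi.single (3, 3) 1 : Fin 4 × Fin 4 → K) p + x 1 * (Pi.single (0, 0) 1 : Fin 4 × Fin 4 → K) p +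
      x 2 * (Pi.single (3, 0) 1 : Fin 4 × Fin 4 → K) p + x 3 * (Pi.single (3, 1) 1 : Fin 4 × Fin 4 → K) p +
      x 4 * (Pi.single (0, 3) 1 : Fin 4 × Fin 4 → K) p + x 5 * (Pi.single (1, 3) 1 : Fin 4 × Fin 4 → K) p := by
    intro x p
    simp only [emb, LinearMap.add_apply, LinearMap.smulRight_apply, LinearMap.coe_proj, Function.eval,
      Pi.add_apply, Pi.smul_apply, smul_eq_mul]
  -- `per` of the block vanishes
  have hP3 : y (0, 0) * (y (1, 1) * y (2, 2) + y (1, 2) * y (2, 1)) +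
      y (0, 1) * (y (1, 0) * y (2, 2) + y (1, 2) * y (2, 0)) +
      y (0, 2) * (y (1, 0) * y (2, 1) + y (1, 1) * y (2, 0)) = 0 := by
    have h := hS Fin.castSucc Fin.castSucc (Fin.castSucc_injective 3) (Fin.castSucc_injective 3)
    rw [Matrix.permanent_fin_three_row] at h
    simpa [Matrix.submatrix_apply] using h
  -- abbreviations for the `s²`-coefficient on the test space
  set C00 := y (1, 1) * y (2, 2) + y (1, 2) * y (2, 1) with hC00
  set C11 := y (0, 0) * y (2, 2) + y (0, 2) * y (2, 0) with hC11
  set C01 := y (1, 0) * y (2, 2) + y (1, 2) * y (2, 0) with hC01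
  set C10 := y (0, 1) * y (2, 2) + y (0, 2) * y (2, 1) with hC10
  -- the identity `Σ c_k Λ_k(emb x)² = Q(x)` on the test space
  have hQ : ∀ x : Fin 6 → K, ∑ k, c k * (Λ k (emb x)) ^ 2 =
      C00 * (x 0 * x 1 + x 2 * x 4) + C10 * (x 2 * x 5) + C01 * (x 3 * x 4) + C11 * (x 3 * x 5) := by
    intro x
    obtain ⟨e₀, e₁, he⟩ := hfam (emb x)
    have hmat : ∀ s : K, (Matrix.of fun i j => (emb x + s • y) (i, j)) =
        Matrix.of ![![x 1 + s * y (0, 0), s * y (0, 1), s * y (0, 2), x 4],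
                   ![s * y (1, 0), s * y (1, 1), s * y (1, 2), x 5],
                   ![s * y (2, 0), s * y (2, 1), s * y (2, 2), 0],
                   ![x 2, x 3, 0, x 0]] := fun s => by
      ext i j
      fin_cases i <;> fin_cases j <;> simp [hemb, hr, hc, Pi.single_apply]
    have hexp : ∀ s : K, e₀ + s * e₁ + s ^ 2 * ∑ k, c k * (Λ k (emb x)) ^ 2 =
        s * (x 1 * x 3 * x 5 * y (2, 2)) +
        s ^ 2 * (C00 * (x 0 * x 1 + x 2 * x 4) + C10 * (x 2 * x 5) + C01 * (x 3 * x 4) +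
          C11 * (x 3 * x 5)) := fun s => by
      rw [← he s, eval_perPoly, hmat s, permanent_test, hP3, mul_zero, mul_zero, add_zero]
    have h0 := hexp 0
    have h1 := hexp 1
    have h1' := hexp (-1)
    have h2 : (2 : K) * ∑ k, c k * (Λ k (emb x)) ^ 2 =
        2 * (C00 * (x 0 * x 1 + x 2 * x 4) + C10 * (x 2 * x 5) + C01 * (x 3 * x 4) + C11 * (x 3 * x 5)) := by
      linear_combination h1 + h1' - 2 * h0
    exact (mul_right_inj' two_ne_zero).1 h2
  -- a common zero of the `Λ_k` on the test space
  let L : (Fin 6 → K) →ₗ[K] (Fin 4 → K) := LinearMap.pi fun k => (Λ k).comp emb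
  have hker : LinearMap.ker L ≠ ⊥ :=
    LinearMap.ker_ne_bot_of_finrank_lt (by
      rw [finrank_fintype_fun_eq_card, finrank_fintype_fun_eq_card, Fintype.card_fin, Fintype.card_fin]
      omega)
  obtain ⟨x₀, hx₀, hx₀ne⟩ := Submodule.exists_mem_ne_zero_of_ne_bot hker
  have hΛ : ∀ k, Λ k (emb x₀) = 0 := fun k => by
    have := congr_fun (LinearMap.mem_ker.1 hx₀) k
    simpa [L] using this
  -- polarisation: `Q(x₀ + x) = Q(x)` for every `x`
  have hinv : ∀ x : Fin 6 → K,
      C00 * ((x₀ + x) 0 * (x₀ + x) 1 + (x₀ + x) 2 * (x₀ + x) 4) + C10 * ((x₀ + x) 2 * (x₀ + x) 5) +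
        C01 * ((x₀ + x) 3 * (x₀ + x) 4) + C11 * ((x₀ + x) 3 * (x₀ + x) 5) =
      C00 * (x 0 * x 1 + x 2 * x 4) + C10 * (x 2 * x 5) + C01 * (x 3 * x 4) + C11 * (x 3 * x 5) := by
    intro x
    have h1 := hQ (x₀ + x)
    have h2 := hQ x
    rw [map_add] at h1
    simp_rw [LinearMap.map_add, hΛ, zero_add] at h1
    rw [← h1, ← h2]
  have h00 : C00 * (x₀ 0 * x₀ 1 + x₀ 2 * x₀ 4) + C10 * (x₀ 2 * x₀ 5) + C01 * (x₀ 3 * x₀ 4) +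
      C11 * (x₀ 3 * x₀ 5) = 0 := by
    have h' := hinv 0
    simpa using h'
  -- the polarised identity `B(x₀, x) = 0`
  have hB : ∀ x : Fin 6 → K,
      C00 * (x₀ 0 * x 1 + x 0 * x₀ 1 + x₀ 2 * x 4 + x 2 * x₀ 4) + C10 * (x₀ 2 * x 5 + x 2 * x₀ 5) +
        C01 * (x₀ 3 * x 4 + x 3 * x₀ 4) + C11 * (x₀ 3 * x 5 + x 3 * x₀ 5) = 0 := by
    intro x
    have h := hinv x
    simp only [Pi.add_apply] at h
    linear_combination h - h00
  -- test against the six unit vectors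
  have la : C00 * x₀ 0 = 0 := by
    have h := hB ![0, 1, 0, 0, 0, 0]
    simp only [Matrix.cons_val_zero, Matrix.cons_val_one, Matrix.cons_val, mul_one, mul_zero, zero_mul,
      add_zero] at h
    linear_combination h
  have lb : C00 * x₀ 1 = 0 := by
    have h := hB ![1, 0, 0, 0, 0, 0]
    simp only [Matrix.cons_val_zero, Matrix.cons_val_one, Matrix.cons_val, mul_zero, zero_mul,
      add_zero, zero_add] at h
    linear_combination h
  have lc1 : C00 * x₀ 4 + C10 * x₀ 5 = 0 := by
    have h := hB ![0, 0, 1, 0, 0, 0]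
    simp only [Matrix.cons_val_zero, Matrix.cons_val_one, Matrix.cons_val, mul_zero, zero_mul,
      add_zero, zero_add] at h
    linear_combination h
  have lc2 : C01 * x₀ 4 + C11 * x₀ 5 = 0 := by
    have h := hB ![0, 0, 0, 1, 0, 0]
    simp only [Matrix.cons_val_zero, Matrix.cons_val_one, Matrix.cons_val, mul_zero, zero_mul,
      add_zero, zero_add] at h
    linear_combination h
  have ld1 : C00 * x₀ 2 + C01 * x₀ 3 = 0 := by
    have h := hB ![0, 0, 0, 0, 1, 0]
    simp only [Matrix.cons_val_zero, Matrix.cons_val_one, Matrix.cons_val, mul_one, mul_zero, zero_mul,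
      add_zero, zero_add] at h
    linear_combination h
  have ld2 : C10 * x₀ 2 + C11 * x₀ 3 = 0 := by
    have h := hB ![0, 0, 0, 0, 0, 1]
    simp only [Matrix.cons_val_zero, Matrix.cons_val_one, Matrix.cons_val, mul_one, mul_zero, zero_mul,
      add_zero, zero_add] at h
    linear_combination h
  have hx0 : x₀ 0 = 0 := (mul_eq_zero.1 la).resolve_left hC
  have hx1 : x₀ 1 = 0 := (mul_eq_zero.1 lb).resolve_left hC
  have hx4 : x₀ 4 = 0 := by
    have : (C00 * C11 - C01 * C10) * x₀ 4 = 0 := by linear_combination C11 * lc1 - C10 * lc2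
    exact (mul_eq_zero.1 this).resolve_left hM
  have hx5 : x₀ 5 = 0 := by
    have : (C00 * C11 - C01 * C10) * x₀ 5 = 0 := by linear_combination (-C01) * lc1 + C00 * lc2
    exact (mul_eq_zero.1 this).resolve_left hM
  have hx2 : x₀ 2 = 0 := by
    have : (C00 * C11 - C01 * C10) * x₀ 2 = 0 := by linear_combination C11 * ld1 - C01 * ld2
    exact (mul_eq_zero.1 this).resolve_left hM
  have hx3 : x₀ 3 = 0 := by
    have : (C00 * C11 - C01 * C10) * x₀ 3 = 0 := by linear_combination (-C10) * ld1 + C00 * ld2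
    exact (mul_eq_zero.1 this).resolve_left hM
  apply hx₀ne
  funext i
  fin_cases i
  · exact hx0
  · exact hx1
  · exact hx2
  · exact hx3
  · exact hx4
  · exact hx5

/-! ## 3. Transport: every (cell, minor) configuration -/

/-- A permutation of `Fin 4` fixing `3` with prescribed values on `0, 1, 2`. [folklore] -/
theorem exists_perm_fix3 : ∀ a b c : Fin 4, a ≠ b → a ≠ c → b ≠ c → a ≠ 3 → b ≠ 3 → c ≠ 3 →
    ∃ σ : Equiv.Perm (Fin 4), σ 0 = a ∧ σ 1 = b ∧ σ 2 = c ∧ σ 3 = 3 := by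
  decide

/-- **Hessian reading at a `3 × 3` block, all positions.**  For every ordering `(ρ₀, ρ₁, ρ₂)` of the
block rows and `(κ₀, κ₁, κ₂)` of the block columns: with `A = C_{ρ₀κ₀}`, `B = C_{ρ₁κ₁}`, `D = C_{ρ₀κ₁}`,
`E = C_{ρ₁κ₀}` (permanental cofactors of the block), `A · (A B − D E) = 0` — i.e. (cofactor entry) ×
(a `2 × 2` minor of the cofactor matrix through it) vanishes.  Transport of `cofactor_master` by
`prodCongr σ τ` (`per₄`-invariant, ✓ `eval_perPoly_comp_prodCongr`, family moved by ✓ `sum_sq_swap_map`).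
[folklore] -/
theorem cofactor_product_eq_zero [CharZero K] (y : Fin 4 × Fin 4 → K) (hr : ∀ m, y (3, m) = 0)
    (hc : ∀ m, y (m, 3) = 0)
    (hS : ∀ (r c : Fin 3 → Fin 4), Function.Injective r → Function.Injective c →
      ((Matrix.of fun a b => y (a, b)).submatrix r c).permanent = 0)
    (hF : ∃ (c : Fin 4 → K) (Λ : Fin 4 → ((Fin 4 × Fin 4 → K) →ₗ[K] K)),
      ∀ u : Fin 4 × Fin 4 → K, ∃ e₀ e₁ : K, ∀ s : K,
        eval (u + s • y) (perPoly (Fin 4) K) = e₀ + s * e₁ + s ^ 2 * ∑ k, c k * (Λ k u) ^ 2)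
    (ρ₀ ρ₁ ρ₂ κ₀ κ₁ κ₂ : Fin 4) (hρ₀₁ : ρ₀ ≠ ρ₁) (hρ₀₂ : ρ₀ ≠ ρ₂) (hρ₁₂ : ρ₁ ≠ ρ₂) (hρ₀ : ρ₀ ≠ 3)
    (hρ₁ : ρ₁ ≠ 3) (hρ₂ : ρ₂ ≠ 3) (hκ₀₁ : κ₀ ≠ κ₁) (hκ₀₂ : κ₀ ≠ κ₂) (hκ₁₂ : κ₁ ≠ κ₂) (hκ₀ : κ₀ ≠ 3)
    (hκ₁ : κ₁ ≠ 3) (hκ₂ : κ₂ ≠ 3) :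
    (y (ρ₁, κ₁) * y (ρ₂, κ₂) + y (ρ₁, κ₂) * y (ρ₂, κ₁)) *
      ((y (ρ₁, κ₁) * y (ρ₂, κ₂) + y (ρ₁, κ₂) * y (ρ₂, κ₁)) * (y (ρ₀, κ₀) * y (ρ₂, κ₂) + y (ρ₀, κ₂) * y (ρ₂, κ₀)) -
        (y (ρ₁, κ₀) * y (ρ₂, κ₂) + y (ρ₁, κ₂) * y (ρ₂, κ₀)) * (y (ρ₀, κ₁) * y (ρ₂, κ₂) + y (ρ₀, κ₂) * y (ρ₂, κ₁))) = 0 := by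
  obtain ⟨σ, hσ0, hσ1, hσ2, hσ3⟩ := exists_perm_fix3 ρ₀ ρ₁ ρ₂ hρ₀₁ hρ₀₂ hρ₁₂ hρ₀ hρ₁ hρ₂
  obtain ⟨τ, hτ0, hτ1, hτ2, hτ3⟩ := exists_perm_fix3 κ₀ κ₁ κ₂ hκ₀₁ hκ₀₂ hκ₁₂ hκ₀ hκ₁ hκ₂
  obtain ⟨c, Λ, h⟩ := hF
  set e := Equiv.prodCongr σ τ with he
  set Φ : (Fin 4 × Fin 4 → K) ≃ₗ[K] (Fin 4 × Fin 4 → K) := LinearEquiv.funCongrLeft K K e with hΦ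
  have hΦa : ∀ (x : Fin 4 × Fin 4 → K) (i j : Fin 4), Φ x (i, j) = x (σ i, τ j) := fun x i j => by
    simp [hΦ, he]
  have hΦper : ∀ z, eval (Φ z) (perPoly (Fin 4) K) = eval z (perPoly (Fin 4) K) := fun z => by
    have : (Φ z : Fin 4 × Fin 4 → K) = z ∘ e := rfl
    rw [this, he, eval_perPoly_comp_prodCongr]
  have h' := sum_sq_swap_map Φ hΦper y c Λ h
  have key := cofactor_master (Φ y) (fun m => by rw [hΦa, hσ3]; exact hr _)
    (fun m => by rw [hΦa, hτ3]; exact hc _)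
    (fun r c' hri hci => by
      have h1 := hS (σ ∘ r) (τ ∘ c') (σ.injective.comp hri) (τ.injective.comp hci)
      have hmat : (Matrix.of fun a b => Φ y (a, b)).submatrix r c' =
          (Matrix.of fun a b => y (a, b)).submatrix (σ ∘ r) (τ ∘ c') := by
        ext a b; simp [hΦa]
      rw [hmat]; exact h1)
    ⟨c, _, h'⟩
  simp only [hΦa, hσ0, hσ1, hσ2, hτ0, hτ1, hτ2] at key
  exact key

end Summit.ValiantsHypothesis.ValiantsHypothesis.Theorems.SymPencilPerFourBlockPointHessian

end
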